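/-
Copyright (c) 2026. All rights reserved.
Released under Apache 2.0 license as described in the file LICENSE.
Authors: abc-iut cell, seat abc-iut-w5-d116 (gen 6).
-/
import Mathlib.LinearAlgebra.Dual.Lemmas
import Mathlib.LinearAlgebra.Quotient.Basic
import Mathlib.LinearAlgebra.Isomorphisms
import Mathlib.FieldTheory.Finite.Basic
import Mathlib.GroupTheory.Index
import Mathlib.Topology.Algebra.Group.Basic
import Mathlib.Topology.Algebra.Monoid
import Mathlib.Topology.Constructions
import Mathlib.Topology.Algebra.Category.ProfiniteGrp.Basic
import Literature.GroupTheory.NikolovSegal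
import HarnessLib

/-!
# The product `(ℤ/p)^ℕ` is not strongly complete: the finite-generation hypothesis of Nikolov–Segal
# cannot be dropped

N. Nikolov, D. Segal, *On finitely generated profinite groups I: strong completeness and uniform bounds*,
Ann. of Math. 165 (2007) [NikolovSegal2007], Thm 1.1: every finite-index subgroup of a TOPOLOGICALLY FINITELY
GENERATED profinite group is open (tree: the named fact `Literature.GroupTheory.NikolovSegalStatement`, not
asserted; Serre's pro-`p` case PROVED in `ProPStronglyComplete.lean`).  The finite-generation hypothesis is
necessary, by the standard example recorded here as a KERNEL CERTIFICATE (proof-only — no definitions; Mathlib-only; stated for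
any finite field `K` with its discrete topology, e.g. `K = ZMod p`):

* `exists_index_eq_not_isOpen_pi` — the compact abelian group `∏_{n : ℕ} K` (product topology of the discrete
  finite field `K`) has an additive subgroup of index `|K|` that is NOT open.  Proof: `V := (ℕ → K)` is a
  `K`-vector space; the finitely supported sequences form a proper subspace `D` (the constant sequence `1` is not
  in it), so some linear functional `f` vanishes on `D` but not everywhere (`Module.forall_dual_apply_eq_zero_iff`
  on `V ⧸ D`); `ker f` has index `|K|` (`f` is onto `K`), and were it open it would contain a basic neighbourhood
  `{x | ∀ i ∈ I, x i = 0}` of `0`, hence — together with `D` — all of `V`.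
* `exists_finiteIndex_not_isOpen_pi` — the multiplicative transport: a finite-index, non-open SUBGROUP of the
  topological group `Multiplicative (ℕ → K)`.
* `not_nikolovSegal_without_tfg` — hence «every finite-index subgroup of every compact totally disconnected
  topological group is open» is FALSE (witness `(ℤ/p)^ℕ`): the hypothesis «topologically finitely generated» of
  `NikolovSegalStatement` cannot be dropped.
* `not_isOpen_comap_of_surjective` / `exists_finiteIndex_not_isOpen_of_surjective` — strong completeness
  DESCENDS along continuous surjections from compact groups onto Hausdorff groups (a continuous surjection from a
  compact space to a Hausdorff space is a quotient map), so ANY compact group mapping continuously ONTO `(ℤ/p)^ℕ`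
  has a non-open finite-index subgroup — e.g. (in print, not typed here) a free pro-`p` group of infinite rank,
  such as the wild inertia group of a `p`-adic field: the structural route to «F-1977 at `G_k`» cannot rest on
  the wild inertia alone (abc-iut cell, FRAMING of F-1977@`G_k`, GAP-LEDGER G-L3d2g2-1; referee note abc-iut-w4-d069).
* (v2) `not_forall_profiniteGrp_finiteIndex_isOpen` — the same in the vocabulary of the cell's F-1977
  `Rmk253.FiniteIndexOpenOfTopFG` (Mathlib `ProfiniteGrp`): the hypothesis-free variant is false.

Classical; nothing here bears on [IUTchIII] Cor. 3.12.
-/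

noncomputable section

open scoped Classical

namespace Literature.GroupTheory

universe u

/-! ### The additive counterexample in `(ℕ → K)`, `K` a finite field with the discrete topology -/

section Additive

variable (K : Type u) [Field K]

/-- **`K^ℕ` (`K` a finite field, discrete) has an additive subgroup of index `|K|` that is not open** for the
product topology.  There is a `K`-linear functional `f` on `ℕ → K` killing all finitely supported sequences but
not the constant `1`; its kernel has index `|K|` and is not open (an open subgroup contains a basic
neighbourhood `{x | ∀ i ∈ I, x i = 0}`, `I` finite, which together with the finitely supported sequences spans
everything). [cite: NikolovSegal2007, §1 (finite generation is necessary)] -/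
theorem exists_index_eq_not_isOpen_pi [TopologicalSpace K] [DiscreteTopology K] :
    ∃ U : AddSubgroup (ℕ → K), U.index = Nat.card K ∧ ¬ IsOpen (U : Set (ℕ → K)) := by
  set V := ℕ → K with hV
  -- the finitely supported sequences, a `K`-subspace `D` (a `let`, no definition of record)
  let D : Submodule K V :=
    { carrier := {x | ∃ N : ℕ, ∀ i, N ≤ i → x i = 0}
      zero_mem' := ⟨0, fun _ _ => rfl⟩
      add_mem' := by
        rintro x y ⟨N, hN⟩ ⟨M, hM⟩
        refine ⟨max N M, fun i hi => ?_⟩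
        rw [Pi.add_apply, hN i (le_of_max_le_left hi), hM i (le_of_max_le_right hi), add_zero]
      smul_mem' := by
        rintro a x ⟨N, hN⟩
        exact ⟨N, fun i hi => by rw [Pi.smul_apply, hN i hi, smul_zero]⟩ }
  have hmemD : ∀ x : V, x ∈ D ↔ ∃ N : ℕ, ∀ i, N ≤ i → x i = 0 := fun x => Iff.rfl
  -- a functional vanishing on `D`, non-zero on the constant sequence `1`
  set c : V := fun _ => 1 with hc
  have hcD : Submodule.Quotient.mk (p := D) c ≠ 0 := by
    intro h
    rw [Submodule.Quotient.mk_eq_zero, hmemD] at h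
    obtain ⟨N, hN⟩ := h
    exact one_ne_zero (hN N le_rfl)
  obtain ⟨φ, hφ⟩ : ∃ φ : Module.Dual K (V ⧸ D), φ (Submodule.Quotient.mk c) ≠ 0 := by
    by_contra hall
    apply hcD
    refine (Module.forall_dual_apply_eq_zero_iff K _).mp fun φ => ?_
    by_contra hφ
    exact hall ⟨φ, hφ⟩
  set f : V →ₗ[K] K := φ.comp D.mkQ with hf
  have hfD : ∀ x ∈ D, f x = 0 := by
    intro x hx
    rw [hf, LinearMap.comp_apply, Submodule.mkQ_apply, (Submodule.Quotient.mk_eq_zero D).mpr hx, map_zero]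
  have hfc : f c ≠ 0 := hφ
  -- its kernel, as an additive subgroup
  refine ⟨(LinearMap.ker f).toAddSubgroup, ?_, ?_⟩
  · -- index `|K|`: `f` is onto the field `K`
    have hsurj : Function.Surjective f := by
      intro t
      refine ⟨(t * (f c)⁻¹) • c, ?_⟩
      rw [map_smul, smul_eq_mul, inv_mul_cancel_right₀ hfc]
    change Nat.card (V ⧸ LinearMap.ker f) = Nat.card K
    exact Nat.card_congr (f.quotKerEquivOfSurjective hsurj).toEquiv
  · -- not open
    intro hopen
    have h0 : (0 : V) ∈ ((LinearMap.ker f).toAddSubgroup : Set V) := zero_mem _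
    -- a basic neighbourhood of `0` inside the kernel
    obtain ⟨I, t, htI, hsub⟩ := isOpen_pi_iff.mp hopen 0 h0
    -- `1 = (part supported on I) + (part vanishing on I)`
    apply hfc
    let cI : V := fun i => if i ∈ I then (1 : K) else 0
    let cI' : V := fun i => if i ∈ I then (0 : K) else 1
    have hsplit : c = cI + cI' := by
      funext i
      change (1 : K) = (if i ∈ I then (1 : K) else 0) + (if i ∈ I then (0 : K) else 1)
      by_cases hi : i ∈ I
      · rw [if_pos hi, if_pos hi, add_zero]
      · rw [if_neg hi, if_neg hi, zero_add]
    have hcI_mem : cI ∈ D := by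
      refine (hmemD cI).mpr ⟨I.sup id + 1, fun i hi => ?_⟩
      have hiI : i ∉ I := by
        intro hiI
        have : i ≤ I.sup id := Finset.le_sup (f := id) hiI
        omega
      change (if i ∈ I then (1 : K) else 0) = 0
      rw [if_neg hiI]
    have hcI'_mem : cI' ∈ ((LinearMap.ker f).toAddSubgroup : Set V) := by
      apply hsub
      refine Set.mem_pi.mpr fun i hi => ?_
      have hi' : i ∈ I := Finset.mem_coe.mp hi
      change (if i ∈ I then (0 : K) else 1) ∈ t i
      rw [if_pos hi']
      exact (htI i hi').2
    have hcI'_ker : f cI' = 0 := hcI'_mem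
    rw [hsplit, map_add, hfD cI hcI_mem, hcI'_ker, add_zero]

/-- **Multiplicative transport**: a finite-index subgroup of the topological group `Multiplicative (ℕ → K)`
(`K` a finite field, discrete; product topology) that is not open.
[cite: NikolovSegal2007, §1 (finite generation is necessary)] -/
theorem exists_finiteIndex_not_isOpen_pi [Finite K] [TopologicalSpace K] [DiscreteTopology K] :
    ∃ U : Subgroup (Multiplicative (ℕ → K)), U.FiniteIndex ∧
      ¬ IsOpen (U : Set (Multiplicative (ℕ → K))) := by
  obtain ⟨U, hUi, hUo⟩ := exists_index_eq_not_isOpen_pi K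
  refine ⟨U.toSubgroup, ⟨?_⟩, ?_⟩
  · rw [AddSubgroup.index_toSubgroup, hUi]
    exact Nat.card_pos.ne'
  · exact hUo

end Additive

/-! ### The finite-generation hypothesis of Nikolov–Segal cannot be dropped -/

/-- **It is FALSE that every finite-index subgroup of every compact, totally disconnected topological group is
open** (witness: `(ℤ/p)^ℕ` for any prime `p`, with the product of the discrete topologies): the hypothesis
«topologically finitely generated» of `NikolovSegalStatement` cannot be dropped.
[cite: NikolovSegal2007, §1 (finite generation is necessary)] -/
theorem not_nikolovSegal_without_tfg (p : ℕ) [Fact p.Prime] :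
    ¬ ∀ (M : Type) [Group M] [TopologicalSpace M] [IsTopologicalGroup M] [CompactSpace M]
        [TotallyDisconnectedSpace M] (U : Subgroup M), U.FiniteIndex → IsOpen (U : Set M) := by
  intro h
  letI : TopologicalSpace (ZMod p) := ⊥
  haveI : DiscreteTopology (ZMod p) := ⟨rfl⟩
  haveI : IsTopologicalAddGroup (ZMod p) :=
    { continuous_add := continuous_of_discreteTopology
      continuous_neg := continuous_of_discreteTopology }
  haveI : Finite (ZMod p) := Finite.of_fintype _
  obtain ⟨U, hUfi, hUo⟩ := exists_finiteIndex_not_isOpen_pi (ZMod p)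
  haveI : CompactSpace (Multiplicative (ℕ → ZMod p)) := inferInstanceAs (CompactSpace (ℕ → ZMod p))
  haveI : TotallyDisconnectedSpace (Multiplicative (ℕ → ZMod p)) :=
    inferInstanceAs (TotallyDisconnectedSpace (ℕ → ZMod p))
  exact hUo (h (Multiplicative (ℕ → ZMod p)) U hUfi)

/-! ### Strong completeness descends along continuous surjections from compact groups -/

section Descent

variable {G M : Type*} [Group G] [TopologicalSpace G] [CompactSpace G]
  [Group M] [TopologicalSpace M] [T2Space M]

/-- Along a continuous SURJECTIVE homomorphism `π : G → M` from a compact group onto a Hausdorff group, the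
preimage of a non-open subgroup is non-open (`π` is a closed map, hence a quotient map).
[cite: NikolovSegal2007, §1 (finite generation is necessary)] -/
theorem not_isOpen_comap_of_surjective (π : G →* M) (hπ : Continuous π) (hsurj : Function.Surjective π)
    (U : Subgroup M) (hU : ¬ IsOpen (U : Set M)) : ¬ IsOpen (U.comap π : Set G) := by
  intro hopen
  apply hU
  have hq : Topology.IsQuotientMap π := (hπ.isClosedMap).isQuotientMap hπ hsurj
  rw [← hq.isOpen_preimage]
  exact hopen

/-- **Strong completeness descends to continuous Hausdorff quotients of compact groups**: if a compact group
`G` maps continuously ONTO a Hausdorff group `M` having a finite-index non-open subgroup, then `G` has one too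
(the preimage).  Contrapositive reading: any profinite group with `(ℤ/p)^ℕ` as a continuous quotient — e.g. a
free pro-`p` group of infinite rank — is not strongly complete. [cite: NikolovSegal2007, §1 (finite generation is necessary)] -/
theorem exists_finiteIndex_not_isOpen_of_surjective (π : G →* M) (hπ : Continuous π)
    (hsurj : Function.Surjective π)
    (hM : ∃ U : Subgroup M, U.FiniteIndex ∧ ¬ IsOpen (U : Set M)) :
    ∃ V : Subgroup G, V.FiniteIndex ∧ ¬ IsOpen (V : Set G) := by
  obtain ⟨U, hUfi, hUo⟩ := hM
  refine ⟨U.comap π, ⟨?_⟩, not_isOpen_comap_of_surjective π hπ hsurj U hUo⟩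
  rw [Subgroup.index_comap_of_surjective U hsurj]
  exact hUfi.index_ne_zero

end Descent


/-! ### In the vocabulary of the cell's F-1977 (`ProfiniteGrp`) -/

/-- **The `ProfiniteGrp` form**: it is FALSE that every finite-index subgroup of every profinite group (Mathlib's
bundled `ProfiniteGrp`) is open — the witness is the profinite group `(ℤ/p)^ℕ`.  This is the hypothesis boundary
of the cell's named fact F-1977 `Rmk253.FiniteIndexOpenOfTopFG` / `NikolovSegalStatement` (both keep the
hypothesis «topologically finitely generated», which `(ℤ/p)^ℕ` violates); it refutes neither.
[cite: NikolovSegal2007, §1 (finite generation is necessary)] -/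
theorem not_forall_profiniteGrp_finiteIndex_isOpen (p : ℕ) [Fact p.Prime] :
    ¬ ∀ (H : ProfiniteGrp.{0}) (U : Subgroup H), U.FiniteIndex → IsOpen (U : Set H) := by
  intro h
  letI : TopologicalSpace (ZMod p) := ⊥
  haveI : DiscreteTopology (ZMod p) := ⟨rfl⟩
  haveI : IsTopologicalAddGroup (ZMod p) :=
    { continuous_add := continuous_of_discreteTopology
      continuous_neg := continuous_of_discreteTopology }
  haveI : Finite (ZMod p) := Finite.of_fintype _
  obtain ⟨U, hUfi, hUo⟩ := exists_finiteIndex_not_isOpen_pi (ZMod p)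
  haveI : CompactSpace (Multiplicative (ℕ → ZMod p)) := inferInstanceAs (CompactSpace (ℕ → ZMod p))
  haveI : TotallyDisconnectedSpace (Multiplicative (ℕ → ZMod p)) :=
    inferInstanceAs (TotallyDisconnectedSpace (ℕ → ZMod p))
  exact hUo (h (ProfiniteGrp.of (Multiplicative (ℕ → ZMod p))) U hUfi)

end Literature.GroupTheory

end
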